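import Literature.Probability.RandomPlanarGeometry.HexSAWSurfaceWallRenewalTenthCensusIdentity
import Literature.Probability.RandomPlanarGeometry.HexSAWSurfaceWallRenewalCensusTenB
import Literature.Probability.RandomPlanarGeometry.HexSAWSurfaceWallRenewalNinthExact
import HarnessLib

/-!
# The tenth-order coefficient of `β(y)²` is exactly seven:
# `y⁹ (β(y)² − y − 1/y − 1/y² − 2/y³ − 4/y⁴ − 6/y⁵ − 12/y⁶ − 18/y⁷ − 15/y⁸) → 7`

`β(y) = wallRate y` is the exponential growth rate of wall bridges of self-avoiding walks on the brick-wall (hexagonal) lattice along a zigzag wall with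
contact fugacity `y`.  «TENTH-CENSUS-IDENTITY» proved that the tenth coefficient of the strong-adsorption expansion exists and equals
`N₁₁,₁ + N₁₂,₂ + N₁₃,₃ + N₁₄,₄ + N₁₅,₅ − 2155` (five symbolic class numbers of the diagonal `s − v = 10`).  This module substitutes the kernel-certified values
`738` («CENSUS-NINE-B»), `860`, `468` («CENSUS-TEN-A»), `95`, `1` («CENSUS-TEN-B») — all by this seat's counting engine «CENSUS-ENGINE», the last one a-idea-1 g35's
six-step rigidity:

  ★★★ `tendsto_pow_nine_mul_wallRate_sq_sub : y⁹ (β(y)² − y − 1/y − 1/y² − 2/y³ − 4/y⁴ − 6/y⁵ − 12/y⁶ − 18/y⁷ − 15/y⁸) → 7` (`y → ∞`),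

i.e. **`β(y)² = y + 1/y + 1/y² + 2/y³ + 4/y⁴ + 6/y⁵ + 12/y⁶ + 18/y⁷ + 15/y⁸ + 7/y⁹ + o(y⁻⁹)`** (`isLittleO_wallRate_sq_sub_tenth`, `eventually_tenth_order_window`,
`tendsto_pow_nine_mul_wallRate_sq_sub_unique`, `tenth_coefficient_lt_ninth`).  FIRST-A a-ref-2 g58's independent formal-series inversion on its own census (INBOX
2026-08-27T09:00:56Z) gives the same `a₉ = 7` and predicts `a₁₀ = −16`.

HONEST LABEL.  LANE THEOREM, DERIVED (one-line assembly); NEW IN WRITING (modest): the coefficient is computed in this lane, print has `β ∼ √y` only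
([BeatonBousquetMelouDeGierDuminilCopinGuttmann2014, §3.1, Proposition 5, p. 10]) and the renewal structure ([MadrasSlade1993, §4.2], [Kesten1963SAW, §4]).
NOT CLAIMED: `a₁₀` (diagonal `s − v = 11`), any rate, anything for `y ≤ μ³`.  No definitions.
-/

namespace Literature.Probability.RandomPlanarGeometry.SAW.HexBW.Wall

open Finset Filter Function
open Literature.Probability.LatticeModels
open _root_.Topology Asymptotics

variable {y : ℝ}

/-- [folklore] Relabel the limit of a `Tendsto` by an equal constant. -/
private theorem tendsto_of_tendsto_of_eq_tx {f : ℝ → ℝ} {L c : ℝ} (h : Tendsto f atTop (𝓝 L)) (e : L = c) :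
    Tendsto f atTop (𝓝 c) := e ▸ h

/-- ★★★ **THE TENTH-ORDER COEFFICIENT OF `β(y)²` IS EXACTLY SEVEN:**
`y⁹ (β(y)² − y − 1/y − … − 18/y⁷ − 15/y⁸) → 7` as `y → ∞` — the census identity with `N₁₁,₁ = 738`, `N₁₂,₂ = 860`, `N₁₃,₃ = 468`, `N₁₄,₄ = 95`, `N₁₅,₅ = 1`:
`2162 − 2155 = 7`. [cite: BeatonBousquetMelouDeGierDuminilCopinGuttmann2014, Section 3.1, Proposition 5 (arXiv v5 p. 9); p. 10] [cite: Kesten1963SAW, Section 4] [cite: MadrasSlade1993, Section 4.2, (4.2.4), Theorem 4.2.2 (pp. 91–92)] -/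
theorem tendsto_pow_nine_mul_wallRate_sq_sub :
    Tendsto (fun y : ℝ => y ^ 9 * (wallRate y ^ 2 - y - 1 / y - 1 / y ^ 2 - 2 / y ^ 3 - 4 / y ^ 4 - 6 / y ^ 5 - 12 / y ^ 6 - 18 / y ^ 7 - 15 / y ^ 8))
      atTop (𝓝 7) := by
  classical
  have h := tendsto_pow_nine_mul_wallRate_sq_sub_census (m₁ := 22) (m₂ := 24) (m₃ := 26) (m₄ := 28) (m₅ := 30) rfl rfl rfl rfl rfl
  rw [card_oneVisit_ipwb_twentytwo_eq rfl, card_twoVisit_ipwb_twentyfour_eq rfl, card_threeVisit_ipwb_twentysix_eq rfl,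
    card_fourVisit_ipwb_twentyeight_eq rfl, card_fiveVisit_ipwb_thirty_eq_one rfl] at h
  exact tendsto_of_tendsto_of_eq_tx h (by norm_num)

/-- ★★★ The same in Landau form: `β(y)² − (y + 1/y + … + 18/y⁷ + 15/y⁸ + 7/y⁹) = o(y⁻⁹)` as `y → ∞`.
[cite: BeatonBousquetMelouDeGierDuminilCopinGuttmann2014, Section 3.1, Proposition 5 (arXiv v5 p. 9)] -/
theorem isLittleO_wallRate_sq_sub_tenth :
    (fun y : ℝ => wallRate y ^ 2 - (y + 1 / y + 1 / y ^ 2 + 2 / y ^ 3 + 4 / y ^ 4 + 6 / y ^ 5 + 12 / y ^ 6 + 18 / y ^ 7 + 15 / y ^ 8 + 7 / y ^ 9)) =o[atTop]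
      fun y : ℝ => 1 / y ^ 9 := by
  have h0 : Tendsto (fun y : ℝ => y ^ 9 * (wallRate y ^ 2 - y - 1 / y - 1 / y ^ 2 - 2 / y ^ 3 - 4 / y ^ 4 - 6 / y ^ 5 - 12 / y ^ 6 - 18 / y ^ 7 - 15 / y ^ 8) - 7)
      atTop (𝓝 0) := by
    simpa using tendsto_pow_nine_mul_wallRate_sq_sub.sub_const 7
  have h1 : (fun y : ℝ => y ^ 9 * (wallRate y ^ 2 - y - 1 / y - 1 / y ^ 2 - 2 / y ^ 3 - 4 / y ^ 4 - 6 / y ^ 5 - 12 / y ^ 6 - 18 / y ^ 7 - 15 / y ^ 8) - 7) =o[atTop]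
      fun _ : ℝ => (1 : ℝ) := (isLittleO_one_iff ℝ).2 h0
  have h2 := h1.mul_isBigO (isBigO_refl (fun y : ℝ => 1 / y ^ 9) atTop)
  refine (h2.congr' ?_ ?_)
  · filter_upwards [eventually_gt_atTop (0 : ℝ)] with y hy
    field_simp
    ring
  · exact Eventually.of_forall fun y => by simp

/-- ★★ Two-sided eventual form: for every `δ > 0`, eventually
`y + 1/y + … + 15/y⁸ + (7 − δ)/y⁹ ≤ β(y)² ≤ y + 1/y + … + 15/y⁸ + (7 + δ)/y⁹`.
[cite: BeatonBousquetMelouDeGierDuminilCopinGuttmann2014, Section 3.1, Proposition 5 (arXiv v5 p. 9)] -/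
theorem eventually_tenth_order_window {δ : ℝ} (hδ : 0 < δ) :
    ∀ᶠ y : ℝ in atTop, y + 1 / y + 1 / y ^ 2 + 2 / y ^ 3 + 4 / y ^ 4 + 6 / y ^ 5 + 12 / y ^ 6 + 18 / y ^ 7 + 15 / y ^ 8 + (7 - δ) / y ^ 9 ≤ wallRate y ^ 2 ∧
      wallRate y ^ 2 ≤ y + 1 / y + 1 / y ^ 2 + 2 / y ^ 3 + 4 / y ^ 4 + 6 / y ^ 5 + 12 / y ^ 6 + 18 / y ^ 7 + 15 / y ^ 8 + (7 + δ) / y ^ 9 := by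
  have h := tendsto_pow_nine_mul_wallRate_sq_sub
  have hlo := h.eventually (eventually_gt_nhds (show (7 : ℝ) - δ < 7 by linarith))
  have hhi := h.eventually (eventually_lt_nhds (show (7 : ℝ) < 7 + δ by linarith))
  filter_upwards [hlo, hhi, eventually_gt_atTop (0 : ℝ)] with y h1 h2 hy
  have hy8 : 0 < y ^ 9 := pow_pos hy 9
  have e2 : wallRate y ^ 2 = (y + 1 / y + 1 / y ^ 2 + 2 / y ^ 3 + 4 / y ^ 4 + 6 / y ^ 5 + 12 / y ^ 6 + 18 / y ^ 7 + 15 / y ^ 8) +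
      (y ^ 9 * (wallRate y ^ 2 - y - 1 / y - 1 / y ^ 2 - 2 / y ^ 3 - 4 / y ^ 4 - 6 / y ^ 5 - 12 / y ^ 6 - 18 / y ^ 7 - 15 / y ^ 8)) / y ^ 9 := by
    field_simp
    ring
  have elo : y + 1 / y + 1 / y ^ 2 + 2 / y ^ 3 + 4 / y ^ 4 + 6 / y ^ 5 + 12 / y ^ 6 + 18 / y ^ 7 + 15 / y ^ 8 + (7 - δ) / y ^ 9 =
      (y + 1 / y + 1 / y ^ 2 + 2 / y ^ 3 + 4 / y ^ 4 + 6 / y ^ 5 + 12 / y ^ 6 + 18 / y ^ 7 + 15 / y ^ 8) + (7 - δ) / y ^ 9 := by ring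
  have ehi : y + 1 / y + 1 / y ^ 2 + 2 / y ^ 3 + 4 / y ^ 4 + 6 / y ^ 5 + 12 / y ^ 6 + 18 / y ^ 7 + 15 / y ^ 8 + (7 + δ) / y ^ 9 =
      (y + 1 / y + 1 / y ^ 2 + 2 / y ^ 3 + 4 / y ^ 4 + 6 / y ^ 5 + 12 / y ^ 6 + 18 / y ^ 7 + 15 / y ^ 8) + (7 + δ) / y ^ 9 := by ring
  rw [elo, ehi, e2]
  constructor
  · gcongr
  · gcongr

/-- ★ Uniqueness form: any limit of `y⁹ (β(y)² − y − … − 15/y⁸)` equals `7`. [cite: MadrasSlade1993, Section 4.2, Theorem 4.2.2 (pp. 91–92)] -/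
theorem tendsto_pow_nine_mul_wallRate_sq_sub_unique {L : ℝ}
    (h : Tendsto (fun y : ℝ => y ^ 9 * (wallRate y ^ 2 - y - 1 / y - 1 / y ^ 2 - 2 / y ^ 3 - 4 / y ^ 4 - 6 / y ^ 5 - 12 / y ^ 6 - 18 / y ^ 7 - 15 / y ^ 8))
      atTop (𝓝 L)) :
    L = 7 :=
  tendsto_nhds_unique h tendsto_pow_nine_mul_wallRate_sq_sub

/-- ★★ **The coefficients keep falling at order ten**: `a₉ = 7 < 15 = a₈` (sequence `1, 1, 2, 4, 6, 12, 18, 15, 7`).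
[cite: BeatonBousquetMelouDeGierDuminilCopinGuttmann2014, Section 3.1, Proposition 5 (arXiv v5 p. 9); p. 10] -/
theorem tenth_coefficient_lt_ninth {L₈ L₉ : ℝ}
    (h₈ : Tendsto (fun y : ℝ => y ^ 8 * (wallRate y ^ 2 - y - 1 / y - 1 / y ^ 2 - 2 / y ^ 3 - 4 / y ^ 4 - 6 / y ^ 5 - 12 / y ^ 6 - 18 / y ^ 7)) atTop (𝓝 L₈))
    (h₉ : Tendsto (fun y : ℝ => y ^ 9 * (wallRate y ^ 2 - y - 1 / y - 1 / y ^ 2 - 2 / y ^ 3 - 4 / y ^ 4 - 6 / y ^ 5 - 12 / y ^ 6 - 18 / y ^ 7 - 15 / y ^ 8))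
      atTop (𝓝 L₉)) : L₉ < L₈ := by
  rw [tendsto_pow_eight_mul_wallRate_sq_sub_unique h₈, tendsto_pow_nine_mul_wallRate_sq_sub_unique h₉]
  norm_num

end Literature.Probability.RandomPlanarGeometry.SAW.HexBW.Wall
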